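import Summits.RiemannHypothesis.RiemannHypothesis.Theorems.ScrewManifestWeakJBound
import HarnessLib

/-!
# RH-FREE: the WEAK PLATEAU BOUND `R_ii·N ≤ 12·log N + 220` for EVERY strictly-DD manifest remainder (any height)

The diagonal analogue of `weakJBound` (p479832), with NO arithmetic input.  Let
`R = S_N − Σ_k w_k A_{t_k} − wJ·J` (`w_k ≥ 0`, arbitrary frequencies and number of atoms, `N = n + 1`) be
STRICTLY diagonally dominant.  Every diagonal entry is positive, and by `remainder_offdiag_eq` and `η ≤ Ψ`
(`remainderFn_le_zetaScrew`) each entry of row `i` satisfies `R_ij ≥ (R_ii + R_jj)/2 − Ψ(x_i − x_j)`.  Summing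
over any set `J` of rows `≠ i` inside the row budget `Σ_{j≠i} |R_ij| < R_ii` gives the

* STAR INEQUALITY `star_ineq` : `(|J| − 2)·R_ii + Σ_{j∈J} R_jj < 2·Σ_{j∈J} Ψ(x_i − x_j)`,

so three or more neighbours bound the diagonal by screw-function values at the lags of the star.  With the
four lower neighbours `m − 1, …, m − 4` of a top-half node `m = i + 2 ≥ N/2` the scaled lags lie in `[1, 10]`,
where the cusp bound `|N·Ψ(s/N) − (s/2)·log N| ≤ 55` (`abs_mul_zetaScrew_div_sub_le_ten`) applies:

* `weakPlateauBound` : `R_ii·(n+1) ≤ 12·log(n+1) + 220` on every top-half row, `n + 1 ≥ 60`;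
* `weakPlateauBound_plateauRows` : `R_ii·(n+1) ≤ 13·log(n+1) + 220` on every row of the slot S2
  `PlateauBound` (`n ≤ 4(i+2)`; lower rows use the star `m ± 1, m ± 2`) — so S2 (`R_ii = O_θ(1/(n+1))`,
  open) holds RH-free up to the same `O(log N) → O(1)` gap as S2a, for every certificate and every height;
* `node_interpolation` : at every top-half node the profile `η = Ψ − Σ_k w_k(1 − cos t_k·)/t_k²` of the
  decomposition equals `wJ/2` up to `(6·log N + 110)/N` (since `R_ii = 2η(x_i) − wJ`).

RH-FREE statements about the certificate FORMAT sos-cert/v1 for truncated screw matrices; nothing here bears on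
the truth of RH.  References: [folklore]; lane record HOME/sos/lean/FORMAT-THEORY-TREE-filer-g4.md §3.
-/

set_option linter.dupNamespace false
set_option autoImplicit false

noncomputable section

open Real Set Finset

namespace Summit.RiemannHypothesis.RiemannHypothesis.Theorems.IntegerScrew.Manifest

open Literature.NumberTheory.LFunctions

/-- Every diagonal entry of a strictly diagonally dominant real matrix is positive. [folklore] -/
theorem diag_pos_of_isStrictDiagDominant {n : ℕ} (R : Matrix (Fin n) (Fin n) ℝ)
    (hD : IsStrictDiagDominant R) (i : Fin n) : 0 < R i i :=
  lt_of_le_of_lt (sum_nonneg fun _ _ => abs_nonneg _) (hD i)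

/-- Entrywise lower bound (RH-FREE): for a manifest remainder with nonnegative weights,
`(R_ii + R_jj)/2 − Ψ(x_i − x_j) ≤ R_ij` (the all-ones weight cancels and `η ≤ Ψ`). [folklore] -/
theorem remainder_entry_lower (n K : ℕ) (t w : Fin K → ℝ) (wJ : ℝ) (hw : ∀ k, 0 ≤ w k) (i j : Fin n) :
    (remainder n K t w wJ i i + remainder n K t w wJ j j) / 2 - zetaScrew (node n i - node n j)
      ≤ remainder n K t w wJ i j := by
  have e := remainder_offdiag_eq n K t w wJ i j
  have h := remainderFn_le_zetaScrew K t w hw (node n i - node n j)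
  rw [e]
  linarith

/-- **STAR INEQUALITY** (RH-FREE, height-free, no arithmetic): for a strictly-DD manifest remainder with
nonnegative weights, every row `i` and every set `J` of rows not containing `i` satisfy
`(|J| − 2)·R_ii + Σ_{j∈J} R_jj < 2·Σ_{j∈J} Ψ(x_i − x_j)`. [folklore] -/
theorem star_ineq (n K : ℕ) (t w : Fin K → ℝ) (wJ : ℝ) (hw : ∀ k, 0 ≤ w k)
    (hD : IsStrictDiagDominant (remainder n K t w wJ)) (i : Fin n) (J : Finset (Fin n)) (hJ : i ∉ J) :
    ((J.card : ℝ) - 2) * remainder n K t w wJ i i + ∑ j ∈ J, remainder n K t w wJ j j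
      < 2 * ∑ j ∈ J, zetaScrew (node n i - node n j) := by
  set R := remainder n K t w wJ with hR
  have hsub : J ⊆ univ.erase i := fun j hj => mem_erase.mpr ⟨fun h => hJ (h ▸ hj), mem_univ _⟩
  have h1 : ∑ j ∈ J, |R i j| ≤ ∑ j ∈ univ.erase i, |R i j| :=
    sum_le_sum_of_subset_of_nonneg hsub fun j _ _ => abs_nonneg _
  have h2 : ∑ j ∈ J, ((R i i + R j j) / 2 - zetaScrew (node n i - node n j)) ≤ ∑ j ∈ J, |R i j| := by
    refine sum_le_sum fun j _ => ?_
    exact (remainder_entry_lower n K t w wJ hw i j).trans (le_abs_self _)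
  have h3 : ∑ j ∈ J, ((R i i + R j j) / 2 - zetaScrew (node n i - node n j))
      = (J.card : ℝ) * (R i i / 2) + (∑ j ∈ J, R j j) / 2
          - ∑ j ∈ J, zetaScrew (node n i - node n j) := by
    rw [sum_sub_distrib]
    congr 1
    have : ∀ j ∈ J, (R i i + R j j) / 2 = R i i / 2 + R j j / 2 := fun j _ => by ring
    rw [sum_congr rfl this, sum_add_distrib, sum_const, nsmul_eq_mul, ← sum_div]
  have hrow := hD i
  have e4 : ((J.card : ℝ) - 2) * R i i = 2 * ((J.card : ℝ) * (R i i / 2)) - 2 * R i i := by ring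
  rw [e4]
  linarith

/-- Four neighbours bound the diagonal (RH-FREE): for pairwise distinct rows `j₁, …, j₄ ≠ i`,
`R_ii < Ψ(x_i − x_{j₁}) + Ψ(x_i − x_{j₂}) + Ψ(x_i − x_{j₃}) + Ψ(x_i − x_{j₄})`. [folklore] -/
theorem diag_lt_sum_four (n K : ℕ) (t w : Fin K → ℝ) (wJ : ℝ) (hw : ∀ k, 0 ≤ w k)
    (hD : IsStrictDiagDominant (remainder n K t w wJ)) (i j₁ j₂ j₃ j₄ : Fin n)
    (h₁ : j₁ ≠ i) (h₂ : j₂ ≠ i) (h₃ : j₃ ≠ i) (h₄ : j₄ ≠ i)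
    (d₁₂ : j₁ ≠ j₂) (d₁₃ : j₁ ≠ j₃) (d₁₄ : j₁ ≠ j₄) (d₂₃ : j₂ ≠ j₃) (d₂₄ : j₂ ≠ j₄) (d₃₄ : j₃ ≠ j₄) :
    remainder n K t w wJ i i
      < zetaScrew (node n i - node n j₁) + zetaScrew (node n i - node n j₂)
        + zetaScrew (node n i - node n j₃) + zetaScrew (node n i - node n j₄) := by
  set R := remainder n K t w wJ with hR
  have hfour := add_four_le_sum (fun j => |R i j|) (univ.erase i) (fun _ => abs_nonneg _) j₁ j₂ j₃ j₄
    (mem_erase.mpr ⟨h₁, mem_univ _⟩) (mem_erase.mpr ⟨h₂, mem_univ _⟩)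
    (mem_erase.mpr ⟨h₃, mem_univ _⟩) (mem_erase.mpr ⟨h₄, mem_univ _⟩) d₁₂ d₁₃ d₁₄ d₂₃ d₂₄ d₃₄
  have hrow := hD i
  have lower : ∀ j : Fin n, R i i / 2 - zetaScrew (node n i - node n j) ≤ |R i j| := by
    intro j
    have e := remainder_entry_lower n K t w wJ hw i j
    have hj := diag_pos_of_isStrictDiagDominant R hD j
    rw [← hR] at e
    exact le_trans (by linarith) (le_abs_self (R i j))
  have l₁ := lower j₁
  have l₂ := lower j₂
  have l₃ := lower j₃
  have l₄ := lower j₄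
  linarith

/-- Scaled cusp bound in slope form (RH-FREE): for `N ≥ 20` and a lag `u` with `1 ≤ N·u ≤ 10`,
`N·Ψ(u) ≤ (N·u/2)·log N + 55`. [folklore] -/
theorem mul_zetaScrew_le_cusp {N u : ℝ} (hN : 20 ≤ N) (h1 : 1 ≤ N * u) (h10 : N * u ≤ 10) :
    N * zetaScrew u ≤ N * u / 2 * Real.log N + 55 := by
  have hN0 : 0 < N := by linarith
  have h := abs_mul_zetaScrew_div_sub_le_ten h1 h10 hN
  rw [mul_div_cancel_left₀ u hN0.ne'] at h
  linarith [(abs_le.mp h).2]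

/-- Four lags in the cusp window bound the scaled diagonal (RH-FREE): if the pairwise distinct rows
`j₁, …, j₄ ≠ i` have lags `u_d` (up to sign) with `1 ≤ N·u_d ≤ s_d ≤ 10`, `N ≥ 20`, then
`N·R_ii < ((s₁ + s₂ + s₃ + s₄)/2)·log N + 220`. [folklore] -/
theorem diag_mul_lt_of_four_lags (n K : ℕ) (t w : Fin K → ℝ) (wJ : ℝ) (hw : ∀ k, 0 ≤ w k)
    (hD : IsStrictDiagDominant (remainder n K t w wJ)) (i j₁ j₂ j₃ j₄ : Fin n)
    (h₁ : j₁ ≠ i) (h₂ : j₂ ≠ i) (h₃ : j₃ ≠ i) (h₄ : j₄ ≠ i)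
    (d₁₂ : j₁ ≠ j₂) (d₁₃ : j₁ ≠ j₃) (d₁₄ : j₁ ≠ j₄) (d₂₃ : j₂ ≠ j₃) (d₂₄ : j₂ ≠ j₄) (d₃₄ : j₃ ≠ j₄)
    {N s₁ s₂ s₃ s₄ u₁ u₂ u₃ u₄ : ℝ} (hN : 20 ≤ N)
    (e₁ : zetaScrew (node n i - node n j₁) = zetaScrew u₁)
    (e₂ : zetaScrew (node n i - node n j₂) = zetaScrew u₂)
    (e₃ : zetaScrew (node n i - node n j₃) = zetaScrew u₃)
    (e₄ : zetaScrew (node n i - node n j₄) = zetaScrew u₄)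
    (lo₁ : 1 ≤ N * u₁) (up₁ : N * u₁ ≤ s₁) (hs₁ : s₁ ≤ 10)
    (lo₂ : 1 ≤ N * u₂) (up₂ : N * u₂ ≤ s₂) (hs₂ : s₂ ≤ 10)
    (lo₃ : 1 ≤ N * u₃) (up₃ : N * u₃ ≤ s₃) (hs₃ : s₃ ≤ 10)
    (lo₄ : 1 ≤ N * u₄) (up₄ : N * u₄ ≤ s₄) (hs₄ : s₄ ≤ 10) :
    N * remainder n K t w wJ i i < (s₁ + s₂ + s₃ + s₄) / 2 * Real.log N + 220 := by
  have hN0 : 0 < N := by linarith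
  have hL0 : 0 ≤ Real.log N := Real.log_nonneg (by linarith)
  have hΨ₁ := mul_zetaScrew_le_cusp hN lo₁ (by linarith only [up₁, hs₁])
  have hΨ₂ := mul_zetaScrew_le_cusp hN lo₂ (by linarith only [up₂, hs₂])
  have hΨ₃ := mul_zetaScrew_le_cusp hN lo₃ (by linarith only [up₃, hs₃])
  have hΨ₄ := mul_zetaScrew_le_cusp hN lo₄ (by linarith only [up₄, hs₄])
  rw [← e₁] at hΨ₁
  rw [← e₂] at hΨ₂
  rw [← e₃] at hΨ₃
  rw [← e₄] at hΨ₄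
  have hlt := diag_lt_sum_four n K t w wJ hw hD i j₁ j₂ j₃ j₄ h₁ h₂ h₃ h₄ d₁₂ d₁₃ d₁₄ d₂₃ d₂₄ d₃₄
  have hltN := mul_lt_mul_of_pos_left hlt hN0
  have t₁ := mul_le_mul_of_nonneg_right up₁ hL0
  have t₂ := mul_le_mul_of_nonneg_right up₂ hL0
  have t₃ := mul_le_mul_of_nonneg_right up₃ hL0
  have t₄ := mul_le_mul_of_nonneg_right up₄ hL0
  have e : N * (zetaScrew (node n i - node n j₁) + zetaScrew (node n i - node n j₂)
      + zetaScrew (node n i - node n j₃) + zetaScrew (node n i - node n j₄))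
      = N * zetaScrew (node n i - node n j₁) + N * zetaScrew (node n i - node n j₂)
        + N * zetaScrew (node n i - node n j₃) + N * zetaScrew (node n i - node n j₄) := by ring
  rw [e] at hltN
  have e' : (s₁ + s₂ + s₃ + s₄) / 2 * Real.log N
      = s₁ * Real.log N / 2 + s₂ * Real.log N / 2 + s₃ * Real.log N / 2 + s₄ * Real.log N / 2 := by
    ring
  rw [e']
  linarith only [hltN, hΨ₁, hΨ₂, hΨ₃, hΨ₄, t₁, t₂, t₃, t₄]

set_option maxHeartbeats 400000 in
/-- **WEAK PLATEAU BOUND, top half (RH-free, height-uniform):** for every wave decomposition of `S_{n+1}`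
with nonnegative weights (any frequencies, any number of atoms, any all-ones weight) whose remainder is
strictly diagonally dominant, `n + 1 ≥ 60`, and every TOP-HALF row `i` (`n + 1 ≤ 2(i+2)`):
`R_ii·(n+1) ≤ 12·log(n+1) + 220` (four lower neighbours, scaled lags `≤ 2.1, 4.3, 6.7, 9.3`). [folklore] -/
theorem weakPlateauBound (n K : ℕ) (t w : Fin K → ℝ) (wJ : ℝ) (hn : 60 ≤ n + 1) (hw : ∀ k, 0 ≤ w k)
    (hD : IsStrictDiagDominant (remainder n K t w wJ)) (i : Fin n) (hi : n + 1 ≤ 2 * ((i : ℕ) + 2)) :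
    remainder n K t w wJ i i * ((n : ℝ) + 1) ≤ 12 * Real.log ((n : ℝ) + 1) + 220 := by
  have hin : (i : ℕ) < n := i.isLt
  set m : ℕ := (i : ℕ) + 2 with hm
  set N : ℝ := (n : ℝ) + 1 with hN
  have hN60 : (60 : ℝ) ≤ N := by rw [hN]; exact_mod_cast hn
  have hL0 : 0 ≤ Real.log N := Real.log_nonneg (by linarith)
  have hmR : N ≤ 2 * (m : ℝ) := by
    have : ((n + 1 : ℕ) : ℝ) ≤ ((2 * m : ℕ) : ℝ) := by exact_mod_cast (by omega : n + 1 ≤ 2 * m)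
    push_cast at this; linarith
  have hmR' : (m : ℝ) ≤ N := by
    have : ((m : ℕ) : ℝ) ≤ ((n + 1 : ℕ) : ℝ) := by exact_mod_cast (by omega : m ≤ n + 1)
    push_cast at this; linarith
  have hm0 : (30 : ℝ) ≤ (m : ℝ) := by exact_mod_cast (by omega : 30 ≤ m)
  -- the four lower neighbours `m − d`, `d = 1, …, 4`: brackets `dN/m ≤ N·lag ≤ dN/(m − d)`
  obtain ⟨i₁, j₁, hi₁, hj₁, hlo₁, hhi₁⟩ := lag_bracket n (m - 1) 1 (by omega) (by omega) (by omega)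
  obtain ⟨i₂, j₂, hi₂, hj₂, hlo₂, hhi₂⟩ := lag_bracket n (m - 2) 2 (by omega) (by omega) (by omega)
  obtain ⟨i₃, j₃, hi₃, hj₃, hlo₃, hhi₃⟩ := lag_bracket n (m - 3) 3 (by omega) (by omega) (by omega)
  obtain ⟨i₄, j₄, hi₄, hj₄, hlo₄, hhi₄⟩ := lag_bracket n (m - 4) 4 (by omega) (by omega) (by omega)
  have e₁ : i₁ = i := Fin.ext (by omega)
  have e₂ : i₂ = i := Fin.ext (by omega)
  have e₃ : i₃ = i := Fin.ext (by omega)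
  have e₄ : i₄ = i := Fin.ext (by omega)
  rw [e₁] at hlo₁ hhi₁
  rw [e₂] at hlo₂ hhi₂
  rw [e₃] at hlo₃ hhi₃
  rw [e₄] at hlo₄ hhi₄
  rw [← hN, Nat.cast_sub (by omega : 1 ≤ m)] at hlo₁ hhi₁
  rw [← hN, Nat.cast_sub (by omega : 2 ≤ m)] at hlo₂ hhi₂
  rw [← hN, Nat.cast_sub (by omega : 3 ≤ m)] at hlo₃ hhi₃
  rw [← hN, Nat.cast_sub (by omega : 4 ≤ m)] at hlo₄ hhi₄
  push_cast at hlo₁ hhi₁ hlo₂ hhi₂ hlo₃ hhi₃ hlo₄ hhi₄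
  -- scaled lags in `[1, s_d]`
  have lo₁ : 1 ≤ N * (node n i - node n j₁) := by
    have : (1 : ℝ) ≤ 1 * N / ((m : ℝ) - 1 + 1) := by
      rw [le_div_iff₀ (by linarith only [hm0])]; linarith only [hmR', hm0]
    linarith only [this, hlo₁]
  have lo₂ : 1 ≤ N * (node n i - node n j₂) := by
    have : (1 : ℝ) ≤ 2 * N / ((m : ℝ) - 2 + 2) := by
      rw [le_div_iff₀ (by linarith only [hm0])]; linarith only [hmR', hm0]
    linarith only [this, hlo₂]
  have lo₃ : 1 ≤ N * (node n i - node n j₃) := by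
    have : (1 : ℝ) ≤ 3 * N / ((m : ℝ) - 3 + 3) := by
      rw [le_div_iff₀ (by linarith only [hm0])]; linarith only [hmR', hm0]
    linarith only [this, hlo₃]
  have lo₄ : 1 ≤ N * (node n i - node n j₄) := by
    have : (1 : ℝ) ≤ 4 * N / ((m : ℝ) - 4 + 4) := by
      rw [le_div_iff₀ (by linarith only [hm0])]; linarith only [hmR', hm0]
    linarith only [this, hlo₄]
  have up₁ : N * (node n i - node n j₁) ≤ 21 / 10 := by
    have : 1 * N / ((m : ℝ) - 1) ≤ 21 / 10 := by
      rw [div_le_iff₀ (by linarith only [hm0])]; linarith only [hmR, hN60]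
    linarith only [this, hhi₁]
  have up₂ : N * (node n i - node n j₂) ≤ 43 / 10 := by
    have : 2 * N / ((m : ℝ) - 2) ≤ 43 / 10 := by
      rw [div_le_iff₀ (by linarith only [hm0])]; linarith only [hmR, hN60]
    linarith only [this, hhi₂]
  have up₃ : N * (node n i - node n j₃) ≤ 67 / 10 := by
    have : 3 * N / ((m : ℝ) - 3) ≤ 67 / 10 := by
      rw [div_le_iff₀ (by linarith only [hm0])]; linarith only [hmR, hN60]
    linarith only [this, hhi₃]
  have up₄ : N * (node n i - node n j₄) ≤ 93 / 10 := by
    have : 4 * N / ((m : ℝ) - 4) ≤ 93 / 10 := by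
      rw [div_le_iff₀ (by linarith only [hm0])]; linarith only [hmR, hN60]
    linarith only [this, hhi₄]
  have key := diag_mul_lt_of_four_lags n K t w wJ hw hD i j₁ j₂ j₃ j₄
    (fun h => by have := congrArg Fin.val h; omega) (fun h => by have := congrArg Fin.val h; omega)
    (fun h => by have := congrArg Fin.val h; omega) (fun h => by have := congrArg Fin.val h; omega)
    (fun h => by have := congrArg Fin.val h; omega) (fun h => by have := congrArg Fin.val h; omega)
    (fun h => by have := congrArg Fin.val h; omega) (fun h => by have := congrArg Fin.val h; omega)
    (fun h => by have := congrArg Fin.val h; omega) (fun h => by have := congrArg Fin.val h; omega)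
    (by linarith only [hN60]) rfl rfl rfl rfl
    lo₁ up₁ (by norm_num) lo₂ up₂ (by norm_num) lo₃ up₃ (by norm_num) lo₄ up₄ (by norm_num)
  have e2 : remainder n K t w wJ i i * N = N * remainder n K t w wJ i i := by ring
  rw [e2]
  norm_num at key
  linarith only [key, hL0]

set_option maxHeartbeats 400000 in
/-- **WEAK PLATEAU BOUND on the plateau rows (RH-free, height-uniform)** — the row range of the slot S2
`PlateauBound` (`n ≤ 4(i+2)`): for every strictly-DD manifest remainder with nonnegative weights, `n + 1 ≥ 60`,
`R_ii·(n+1) ≤ 13·log(n+1) + 220` (top-half rows by `weakPlateauBound`; the others by the star of the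
neighbours `m ± 1, m ± 2`, scaled lags `≤ 4.07, 8.14, 4.37, 9.42`).  So `PlateauBound` holds RH-free with
`A = O(log(n+1))`; the open content of S2 is `O(log) → O(1)`, exactly as for S2a (`weakJBound`). [folklore] -/
theorem weakPlateauBound_plateauRows (n K : ℕ) (t w : Fin K → ℝ) (wJ : ℝ) (hn : 60 ≤ n + 1)
    (hw : ∀ k, 0 ≤ w k) (hD : IsStrictDiagDominant (remainder n K t w wJ)) (i : Fin n)
    (hi : n ≤ 4 * ((i : ℕ) + 2)) :
    remainder n K t w wJ i i * ((n : ℝ) + 1) ≤ 13 * Real.log ((n : ℝ) + 1) + 220 := by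
  by_cases htop : n + 1 ≤ 2 * ((i : ℕ) + 2)
  · have h := weakPlateauBound n K t w wJ hn hw hD i htop
    have hn0 : (0 : ℝ) ≤ (n : ℝ) := Nat.cast_nonneg n
    have hL0 : 0 ≤ Real.log ((n : ℝ) + 1) := Real.log_nonneg (by linarith)
    linarith
  have hin : (i : ℕ) < n := i.isLt
  set m : ℕ := (i : ℕ) + 2 with hm
  have hm2 : 2 * m ≤ n := by omega
  set N : ℝ := (n : ℝ) + 1 with hN
  have hN60 : (60 : ℝ) ≤ N := by rw [hN]; exact_mod_cast hn
  have hL0 : 0 ≤ Real.log N := Real.log_nonneg (by linarith)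
  have hmlo : N - 1 ≤ 4 * (m : ℝ) := by
    have : ((n : ℕ) : ℝ) ≤ ((4 * m : ℕ) : ℝ) := by exact_mod_cast hi
    push_cast at this; linarith
  have hmhi : 2 * (m : ℝ) ≤ N - 1 := by
    have : ((2 * m : ℕ) : ℝ) ≤ ((n : ℕ) : ℝ) := by exact_mod_cast hm2
    push_cast at this; linarith
  have hm0 : (15 : ℝ) ≤ (m : ℝ) := by exact_mod_cast (by omega : 15 ≤ m)
  -- neighbours `m + 1, m + 2` (row `i` is the LOWER node) and `m − 1, m − 2`
  obtain ⟨k₁, l₁, hk₁, hl₁, hlo₁, hhi₁⟩ := lag_bracket n m 1 (by omega) (by omega) (by omega)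
  obtain ⟨k₂, l₂, hk₂, hl₂, hlo₂, hhi₂⟩ := lag_bracket n m 2 (by omega) (by omega) (by omega)
  obtain ⟨i₃, j₃, hi₃, hj₃, hlo₃, hhi₃⟩ := lag_bracket n (m - 1) 1 (by omega) (by omega) (by omega)
  obtain ⟨i₄, j₄, hi₄, hj₄, hlo₄, hhi₄⟩ := lag_bracket n (m - 2) 2 (by omega) (by omega) (by omega)
  have f₁ : l₁ = i := Fin.ext (by omega)
  have f₂ : l₂ = i := Fin.ext (by omega)
  have e₃ : i₃ = i := Fin.ext (by omega)
  have e₄ : i₄ = i := Fin.ext (by omega)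
  rw [f₁] at hlo₁ hhi₁
  rw [f₂] at hlo₂ hhi₂
  rw [e₃] at hlo₃ hhi₃
  rw [e₄] at hlo₄ hhi₄
  rw [← hN] at hlo₁ hhi₁ hlo₂ hhi₂
  rw [← hN, Nat.cast_sub (by omega : 1 ≤ m)] at hlo₃ hhi₃
  rw [← hN, Nat.cast_sub (by omega : 2 ≤ m)] at hlo₄ hhi₄
  push_cast at hlo₁ hhi₁ hlo₂ hhi₂ hlo₃ hhi₃ hlo₄ hhi₄
  have lo₁ : 1 ≤ N * (node n k₁ - node n i) := by
    have : (1 : ℝ) ≤ 1 * N / ((m : ℝ) + 1) := by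
      rw [le_div_iff₀ (by linarith only [hm0])]; linarith only [hmhi, hm0]
    linarith only [this, hlo₁]
  have lo₂ : 1 ≤ N * (node n k₂ - node n i) := by
    have : (1 : ℝ) ≤ 2 * N / ((m : ℝ) + 2) := by
      rw [le_div_iff₀ (by linarith only [hm0])]; linarith only [hmhi, hm0]
    linarith only [this, hlo₂]
  have lo₃ : 1 ≤ N * (node n i - node n j₃) := by
    have : (1 : ℝ) ≤ 1 * N / ((m : ℝ) - 1 + 1) := by
      rw [le_div_iff₀ (by linarith only [hm0])]; linarith only [hmhi, hm0]
    linarith only [this, hlo₃]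
  have lo₄ : 1 ≤ N * (node n i - node n j₄) := by
    have : (1 : ℝ) ≤ 2 * N / ((m : ℝ) - 2 + 2) := by
      rw [le_div_iff₀ (by linarith only [hm0])]; linarith only [hmhi, hm0]
    linarith only [this, hlo₄]
  have up₁ : N * (node n k₁ - node n i) ≤ 407 / 100 := by
    have : 1 * N / (m : ℝ) ≤ 407 / 100 := by
      rw [div_le_iff₀ (by linarith only [hm0])]; linarith only [hmlo, hN60]
    linarith only [this, hhi₁]
  have up₂ : N * (node n k₂ - node n i) ≤ 814 / 100 := by
    have : 2 * N / (m : ℝ) ≤ 814 / 100 := by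
      rw [div_le_iff₀ (by linarith only [hm0])]; linarith only [hmlo, hN60]
    linarith only [this, hhi₂]
  have up₃ : N * (node n i - node n j₃) ≤ 437 / 100 := by
    have : 1 * N / ((m : ℝ) - 1) ≤ 437 / 100 := by
      rw [div_le_iff₀ (by linarith only [hm0])]; linarith only [hmlo, hN60]
    linarith only [this, hhi₃]
  have up₄ : N * (node n i - node n j₄) ≤ 942 / 100 := by
    have : 2 * N / ((m : ℝ) - 2) ≤ 942 / 100 := by
      rw [div_le_iff₀ (by linarith only [hm0])]; linarith only [hmlo, hN60]
    linarith only [this, hhi₄]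
  have g₁ : zetaScrew (node n i - node n k₁) = zetaScrew (node n k₁ - node n i) := by
    rw [← zetaScrew_neg]; congr 1; ring
  have g₂ : zetaScrew (node n i - node n k₂) = zetaScrew (node n k₂ - node n i) := by
    rw [← zetaScrew_neg]; congr 1; ring
  have key := diag_mul_lt_of_four_lags n K t w wJ hw hD i k₁ k₂ j₃ j₄
    (fun h => by have := congrArg Fin.val h; omega) (fun h => by have := congrArg Fin.val h; omega)
    (fun h => by have := congrArg Fin.val h; omega) (fun h => by have := congrArg Fin.val h; omega)
    (fun h => by have := congrArg Fin.val h; omega) (fun h => by have := congrArg Fin.val h; omega)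
    (fun h => by have := congrArg Fin.val h; omega) (fun h => by have := congrArg Fin.val h; omega)
    (fun h => by have := congrArg Fin.val h; omega) (fun h => by have := congrArg Fin.val h; omega)
    (by linarith only [hN60]) g₁ g₂ rfl rfl
    lo₁ up₁ (by norm_num) lo₂ up₂ (by norm_num) lo₃ up₃ (by norm_num) lo₄ up₄ (by norm_num)
  have e2 : remainder n K t w wJ i i * N = N * remainder n K t w wJ i i := by ring
  rw [e2]
  norm_num at key
  linarith only [key, hL0]

/-- **NODE INTERPOLATION** (RH-FREE corollary): at every top-half node `x_i = log(i+2)` the profile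
`η = Ψ − Σ_k w_k(1 − cos(t_k·))/t_k²` of a strictly-DD decomposition with nonnegative weights equals `wJ/2`
up to `(6·log(n+1) + 110)/(n+1)` (`R_ii = 2η(x_i) − wJ` lies in `(0, (12 log N + 220)/N]`). [folklore] -/
theorem node_interpolation (n K : ℕ) (t w : Fin K → ℝ) (wJ : ℝ) (hn : 60 ≤ n + 1) (hw : ∀ k, 0 ≤ w k)
    (hD : IsStrictDiagDominant (remainder n K t w wJ)) (i : Fin n) (hi : n + 1 ≤ 2 * ((i : ℕ) + 2)) :
    |remainderFn K t w (node n i) - wJ / 2| * ((n : ℝ) + 1) ≤ 6 * Real.log ((n : ℝ) + 1) + 110 := by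
  have hN0 : (0 : ℝ) < (n : ℝ) + 1 := by positivity
  have h1 := weakPlateauBound n K t w wJ hn hw hD i hi
  have h2 := diag_pos_of_isStrictDiagDominant _ hD i
  have e : remainder n K t w wJ i i = 2 * remainderFn K t w (node n i) - wJ := by
    rw [remainder_apply_remainderFn, sub_self, remainderFn_zero]; ring
  rw [e] at h1 h2
  have h3 : 0 < remainderFn K t w (node n i) - wJ / 2 := by linarith
  rw [abs_of_pos h3]
  nlinarith

end Summit.RiemannHypothesis.RiemannHypothesis.Theorems.IntegerScrew.Manifest

end
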